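import Mathlib.RingTheory.FormalGroup.Basic
import Mathlib.RingTheory.MvPowerSeries.Rename
import HarnessLib

/-!
# Coefficients of a one-dimensional formal group law
# ([Hazewinkel1978] §1.1)

Topic `Literature/RingTheory/FormalGroups`; namespace `Literature.RingTheory.FormalGroups`.  Fully proved theorems about
Mathlib's carrier `FormalGroup R` (`Mathlib.RingTheory.FormalGroup.Basic`); one auxiliary definition (`swapIdx`, the
exchange of the two exponents); no named fact, no instance, no notation, no `sorry`.  Written for the Lazard-ring files
(`LazardRing`, `LazardRingPolynomial`): the relations defining the Lazard ring are read off coefficientwise.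

## Contents
* `swapIdx d` — the exponent `(d₁, d₀)`; `prod_pow_fin_two` (plumbing for `MvPowerSeries.coeff_subst`).
* `coeff_subst_X_zero`, `coeff_subst_zero_X` — the coefficient of `X^k` (resp. `Y^k`) survives `Y ↦ 0` (resp. `X ↦ 0`).
* `coeff_single_zero_formalGroup`, `coeff_single_one_formalGroup`, `coeff_formalGroup_of_not_interior` — `F(X,0) = X` and
  `F(0,Y) = Y` coefficientwise: the only non-interior coefficients of a law are the two linear ones.
* `coeff_subst_swap`, `coeff_swapIdx_formalGroup` — `F(Y,X)` has the swapped coefficients; commutative laws have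
  symmetric coefficients.

## References
* [Hazewinkel1978] M. Hazewinkel, *Formal Groups and Applications* (1978), §1.1 (1.1.1)–(1.1.2).
* [BourbakiAlgebraII2003] N. Bourbaki, *Algebra II*, Ch. IV §5 (formal power series, substitution).
-/

noncomputable section

namespace Literature.RingTheory.FormalGroups

open _root_.MvPowerSeries (HasSubst subst coeff)

universe u

variable {R : Type u} [CommRing R]

/-! ## §1 Coefficients of a formal group law -/

/-- The swapped exponent `d̄ = (d₁, d₀)` of `d = (d₀, d₁) : Fin 2 →₀ ℕ` (the exchange `F(X,Y) ↦ F(Y,X)` on exponents).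
[cite: Hazewinkel1978, §1.1 (1.1.2)] -/
def swapIdx (d : Fin 2 →₀ ℕ) : Fin 2 →₀ ℕ := Finsupp.equivMapDomain (Equiv.swap 0 1) d

/-- `d̄ 0 = d 1`. [cite: Hazewinkel1978, §1.1 (1.1.2)] -/
@[simp] theorem swapIdx_apply_zero (d : Fin 2 →₀ ℕ) : swapIdx d 0 = d 1 := by
  simp [swapIdx, Finsupp.equivMapDomain_apply, Equiv.swap_apply_left]

/-- `d̄ 1 = d 0`. [cite: Hazewinkel1978, §1.1 (1.1.2)] -/
@[simp] theorem swapIdx_apply_one (d : Fin 2 →₀ ℕ) : swapIdx d 1 = d 0 := by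
  simp [swapIdx, Finsupp.equivMapDomain_apply, Equiv.swap_apply_right]

/-- `swapIdx` is an involution. [cite: Hazewinkel1978, §1.1 (1.1.2)] -/
@[simp] theorem swapIdx_swapIdx (d : Fin 2 →₀ ℕ) : swapIdx (swapIdx d) = d := by
  ext i; fin_cases i <;> simp

/-- A `Fin 2`-indexed `Finsupp.prod` of powers is the product of the two powers (the monomial `u^{d₀} v^{d₁}` substituted
for `X^{d₀} Y^{d₁}`). [cite: BourbakiAlgebraII2003, Ch. IV §5 no. 1] -/
theorem prod_pow_fin_two {τ : Type*} (d : Fin 2 →₀ ℕ) (a : Fin 2 → MvPowerSeries τ R) :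
    d.prod (fun s e => a s ^ e) = a 0 ^ d 0 * a 1 ^ d 1 := by
  rw [Finsupp.prod_fintype _ _ (fun i => pow_zero _)]
  exact Fin.prod_univ_two _

/-- The coefficient of `X^k` (no `Y`) survives the substitution `Y ↦ 0`:
`coeff (single 0 k) (F.subst ![X 0, 0]) = coeff (single 0 k) F`. [cite: BourbakiAlgebraII2003, Ch. IV §5 no. 1] -/
theorem coeff_subst_X_zero (F : MvPowerSeries (Fin 2) R) (k : ℕ) :
    coeff (Finsupp.single 0 k) (F.subst ![(MvPowerSeries.X 0 : MvPowerSeries (Fin 2) R), 0]) =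
      coeff (Finsupp.single 0 k) F := by
  classical
  rw [MvPowerSeries.coeff_subst HasSubst.X_zero, finsum_eq_single _ (Finsupp.single 0 k)]
  · simp [MvPowerSeries.coeff_X_pow]
  · intro d hd
    rw [prod_pow_fin_two]
    by_cases h1 : d 1 = 0
    · have hd0 : d 0 ≠ k := by
        intro h0; apply hd; ext i; fin_cases i <;> simp [h0, h1]
      have hne : Finsupp.single (0 : Fin 2) k ≠ Finsupp.single 0 (d 0) := by
        intro h
        rw [Finsupp.single_eq_single_iff] at h
        rcases h with ⟨_, h⟩ | ⟨h, h'⟩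
        · exact hd0 h.symm
        · exact hd0 (h'.trans h.symm)
      simp [h1, MvPowerSeries.coeff_X_pow, hne]
    · simp [zero_pow h1]

/-- Same with the roles of the variables exchanged: `coeff (single 1 k) (F.subst ![0, X 1]) = coeff (single 1 k) F`.
[cite: BourbakiAlgebraII2003, Ch. IV §5 no. 1] -/
theorem coeff_subst_zero_X (F : MvPowerSeries (Fin 2) R) (k : ℕ) :
    coeff (Finsupp.single 1 k) (F.subst ![0, (MvPowerSeries.X 1 : MvPowerSeries (Fin 2) R)]) =
      coeff (Finsupp.single 1 k) F := by
  classical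
  rw [MvPowerSeries.coeff_subst HasSubst.zero_X, finsum_eq_single _ (Finsupp.single 1 k)]
  · simp [MvPowerSeries.coeff_X_pow]
  · intro d hd
    rw [prod_pow_fin_two]
    by_cases h0 : d 0 = 0
    · have hd1 : d 1 ≠ k := by
        intro h1; apply hd; ext i; fin_cases i <;> simp [h0, h1]
      have hne : Finsupp.single (1 : Fin 2) k ≠ Finsupp.single 1 (d 1) := by
        intro h
        rw [Finsupp.single_eq_single_iff] at h
        rcases h with ⟨_, h⟩ | ⟨h, h'⟩
        · exact hd1 h.symm
        · exact hd1 (h'.trans h.symm)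
      simp [h0, MvPowerSeries.coeff_X_pow, hne]
    · simp [zero_pow h0]

/-- **`F(X,0) = X` coefficientwise**: the coefficient of `X^k` in a law is `1` for `k = 1` and `0` otherwise.
[cite: Hazewinkel1978, §1.1 (1.1.2)] -/
theorem coeff_single_zero_formalGroup (G : FormalGroup R) (k : ℕ) :
    coeff (Finsupp.single 0 k) G.toPowerSeries = if k = 1 then 1 else 0 := by
  classical
  have h := G.add_zero (PowerSeries.HasSubst.X (0 : Fin 2))
  have hk := congrArg (coeff (Finsupp.single (0 : Fin 2) k)) h
  rw [coeff_subst_X_zero] at hk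
  rw [hk, MvPowerSeries.coeff_X]
  simp [Finsupp.single_eq_single_iff]

/-- **`F(0,Y) = Y` coefficientwise**: the coefficient of `Y^k` in a law is `1` for `k = 1` and `0` otherwise.
[cite: Hazewinkel1978, §1.1 (1.1.2)] -/
theorem coeff_single_one_formalGroup (G : FormalGroup R) (k : ℕ) :
    coeff (Finsupp.single 1 k) G.toPowerSeries = if k = 1 then 1 else 0 := by
  classical
  have h := G.zero_add (PowerSeries.HasSubst.X (1 : Fin 2))
  have hk := congrArg (coeff (Finsupp.single (1 : Fin 2) k)) h
  rw [coeff_subst_zero_X] at hk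
  rw [hk, MvPowerSeries.coeff_X]
  simp [Finsupp.single_eq_single_iff]

/-- **Non-interior coefficients of a law** (`d₀ = 0` or `d₁ = 0`): they are `1` at `(1,0)`, `(0,1)` and `0` elsewhere.
[cite: Hazewinkel1978, §1.1 (1.1.2)] -/
theorem coeff_formalGroup_of_not_interior (G : FormalGroup R) {d : Fin 2 →₀ ℕ} (hd : ¬(0 < d 0 ∧ 0 < d 1)) :
    coeff d G.toPowerSeries = if d = Finsupp.single 0 1 ∨ d = Finsupp.single 1 1 then 1 else 0 := by
  classical
  rw [not_and_or, not_lt, not_lt, Nat.le_zero, Nat.le_zero] at hd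
  rcases hd with h0 | h1
  · have hd' : d = Finsupp.single 1 (d 1) := by ext i; fin_cases i <;> simp [h0]
    rw [hd', coeff_single_one_formalGroup]
    simp [Finsupp.single_eq_single_iff]
  · have hd' : d = Finsupp.single 0 (d 0) := by ext i; fin_cases i <;> simp [h1]
    rw [hd', coeff_single_zero_formalGroup]
    simp [Finsupp.single_eq_single_iff]

/-- The pair `![X 1, X 0]` is `X ∘ swap`. [folklore] -/
private theorem pair_swap_eq :
    (![MvPowerSeries.X 1, MvPowerSeries.X 0] : Fin 2 → MvPowerSeries (Fin 2) R) =
      MvPowerSeries.X ∘ (Equiv.swap (0 : Fin 2) 1) := by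
  funext i; fin_cases i <;> rfl

/-- `F(Y,X)` has coefficients those of `F` at the swapped exponents:
`coeff d (F.subst ![X 1, X 0]) = coeff d̄ F`. [cite: BourbakiAlgebraII2003, Ch. IV §5 no. 1] -/
theorem coeff_subst_swap (F : MvPowerSeries (Fin 2) R) (d : Fin 2 →₀ ℕ) :
    coeff d (F.subst ![(MvPowerSeries.X 1 : MvPowerSeries (Fin 2) R), MvPowerSeries.X 0]) =
      coeff (swapIdx d) F := by
  have hd : d = Finsupp.embDomain (Equiv.swap (0 : Fin 2) 1).toEmbedding (swapIdx d) := by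
    rw [Finsupp.embDomain_eq_mapDomain, Equiv.coe_toEmbedding, ← Finsupp.equivMapDomain_eq_mapDomain]
    ext i
    fin_cases i <;> simp [Finsupp.equivMapDomain_apply]
  rw [pair_swap_eq, ← MvPowerSeries.rename_eq_subst]
  conv_lhs => rw [hd]
  exact MvPowerSeries.coeff_embDomain_rename (Equiv.swap (0 : Fin 2) 1).toEmbedding F (swapIdx d)

/-- **Commutative laws have symmetric coefficients**: `coeff d̄ G = coeff d G`. [cite: Hazewinkel1978, §1.1 (1.1.2)] -/
theorem coeff_swapIdx_formalGroup (G : FormalGroup R) [G.IsComm] (d : Fin 2 →₀ ℕ) :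
    coeff (swapIdx d) G.toPowerSeries = coeff d G.toPowerSeries := by
  rw [← coeff_subst_swap]
  exact congrArg (coeff d) (FormalGroup.IsComm.comm (F := G)).symm


end Literature.RingTheory.FormalGroups
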